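/-
Origin: expansion seat `prover-pub-hodgecm-mc-binder-2-g7-0`, handover #10 18:25Z md5 8799b309bc22 (131 l.; imports #7 + the twin of `LinearAlgebra/Matrix/SL2DiagonalCommutator` — INSTALL AFTER it, DROP-ONLY-THIS-ROW if absent; `map_cmBlockSectionAt_one_hypV_eq_one` (EVERY hom into a commutative group kills the W-boost curve: `hypV r₀ s₀ t = φV r₀ s₀ (slDiag eᵗ)`, a commutator in SL(2,ℝ)), `eta_archProdHom_cmBlockSectionAt_one_hypV` (= `hη` of #7 for every η), `tendsto_toThetaTop_cmPairRepTwist_one_hypV_sub_div'` (= #7's headline with `hη` DISCHARGED); farm amalgam rc 0 / 0 warn; axioms trio) (`HOME/mc/pub-hodgecm-mc-binder-2/g7/pkg/HodgeCM/Model/HypCensus/SmoothTwist.lean`, md5 8799b309, 131 lines);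
landed by the gen-12 packager (p-g12) in gate run 36 as `HodgeCM/Model/HypCensus/SmoothTwist.lean` (verbatim).
-/
/-
Origin: speedrun cell pub-hodgecm, MODEL-CONSTRUCTION sub-cell, lineage mc-binder-2 (rows A12/A34 of the binder ledger:
`hyp12` / `hyp34`), seat prover-pub-hodgecm-mc-binder-2-g7-0 (gen 7), 2026-08-19.  Target in PKG:
`HodgeCM/Model/HypCensus/SmoothTwist.lean` (NEW additive leaf; imports this lineage's `SmoothTheta` and the K-1 twin of the 78-line tree
file `Literature/LinearAlgebra/Matrix/SL2DiagonalCommutator.lean` (binder-2-g6, p187711; its one import `RotationThreeShears` is a PKG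
twin) — install after that twin).  KERNEL only: 0 records / named facts / proof holes.
-/
import Summits.HodgeConjecture.HodgeCM.Model.HypCensus.SmoothTheta
import Literature.LinearAlgebra.Matrix.SL2DiagonalCommutator

/-!
# Census kit (rows A12/A34), junction (J-smooth): every character is trivial on the `W`-side boost curve (`hη` discharged)

The headline of `SmoothTheta` (`tendsto_toThetaTop_cmPairRepTwist_one_hypV_sub_div`) carries the hypothesis
`hη : ∀ t, η (archProdHom (s (1, a_t))) = 1` — the normalising twist `η` of unitary-1's `wm` input (`cmDetTwistChar χV χW`,
[GelbartRogawski1991, §3.1 Remark p. 457]) must not move along the boost.  It never does, for ANY homomorphism into a commutative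
group: the boost `a_t = hypV r₀ s₀ t = φV r₀ s₀ (diag(eᵗ, e⁻ᵗ))` is the image of a diagonal element of `SL(2,ℝ)` under theta-1's
homomorphism `φV r₀ s₀ : SL(2,ℝ) →* U(R',S')`, and `diag(a, a⁻¹)` (`a > 0`) is ONE commutator in `SL(2,ℝ)` (binder-2-g6's tree lemma
`map_slDiag_exp_eq_one`, `LinearAlgebra/Matrix/SL2DiagonalCommutator`).

* §1 **`map_cmBlockSectionAt_one_hypV_eq_one`** — `c (s (1, a_t)) = 1` for every `c : U(J_V)(L⁺ ⊗ ℝ) × U(J_W)(L⁺ ⊗ ℝ) →* A`, `A`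
  commutative; **`eta_archProdHom_cmBlockSectionAt_one_hypV`** — the `hη` shape of `SmoothTheta` for every `η`.
* §2 **`tendsto_toThetaTop_cmPairRepTwist_one_hypV_sub_div'`** — `SmoothTheta`'s headline with `hη` DISCHARGED.

Nothing here is a claim of PerL/QW8.  Style lint (L-notation): no `local notation`.
-/

set_option autoImplicit false

noncomputable section

open Filter Topology
open NumberField NumberField.InfinitePlace IsDedekindDomain MeasureTheory
open scoped Matrix
open scoped Kronecker Classical TensorProduct ComplexConjugate
open Literature.NumberTheory.Automorphic Literature.NumberTheory.Automorphic.UnitaryGroup Literature.NumberTheory.Weil1964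
open Literature.RepresentationTheory.HeisenbergGroup (polar Heisenberg symplecticGroup ofSymplectic)
open Literature.RepresentationTheory.KonnoKonno2007 Literature.RepresentationTheory.KonnoKonno2007.RealDualPair
open Literature.NumberTheory.GelbartRogawski1991 Literature.NumberTheory.GelbartRogawski1991.UnitaryDualPair
open Literature.Analysis.SegalBargmann Literature.Analysis.Distribution
open Literature.LinearAlgebra.Matrix.RotationThreeShears

namespace HodgeCM.Model.HypCensus

section BoostCharacter

variable (L : Type) [Field L] [NumberField L] [IsCMField L] {N M n : ℕ} (e : Fin N × Fin M ≃ Fin n)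
variable (dV : Fin N → L) (hdV : ∀ i, IsCMField.complexConj L (dV i) = dV i) (hdV0 : ∀ i, dV i ≠ 0)
variable (dW : Fin M → L) (hdW : ∀ i, IsCMField.complexConj L (dW i) = dW i) (hdW0 : ∀ i, dW i ≠ 0)
variable (hGR : (cmSplittingDatum L e dV hdV hdV0 dW hdW hdW0).CompatibleSplitting) (ι₁ : L →+* ℂ)
variable (v : {v : InfinitePlace ↥(maximalRealSubfield L) // v.IsReal})
variable {P' Q' R' S' : Type} [Fintype P'] [DecidableEq P'] [Fintype Q'] [DecidableEq Q'] [Fintype R'] [DecidableEq R']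
  [Fintype S'] [DecidableEq S']
variable (eP : PosIdx (cmXV L dV hdV ι₁ v) ≃ P') (eQ : NegIdx (cmXV L dV hdV ι₁ v) ≃ Q')
  (eR : PosIdx (cmXW L dV dW hdW ι₁ v) ≃ R') (eS : NegIdx (cmXW L dV dW hdW ι₁ v) ≃ S')

/-! ## §1 Characters are trivial on the boost curve -/

/-- **Every homomorphism into a commutative group kills the `W`-side boost curve** `t ↦ s (1, hypV r₀ s₀ t)`: the boost is the
image of `diag(eᵗ, e⁻ᵗ) ∈ SL(2,ℝ)`, a commutator. [folklore] -/
theorem map_cmBlockSectionAt_one_hypV_eq_one {A : Type*} [CommGroup A]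
    (c : UnitaryGroup.arch (↥(maximalRealSubfield L)) L (IsCMField.complexConj L) N (Matrix.diagonal dV) ×
        UnitaryGroup.arch (↥(maximalRealSubfield L)) L (IsCMField.complexConj L) M (Matrix.diagonal dW) →* A)
    (r₀ : R') (s₀ : S') (t : ℝ) :
    c (cmBlockSectionAt L dV hdV hdV0 dW hdW hdW0 ι₁ v eP eQ eR eS
      (((1 : UForm P' Q'), (hypV r₀ s₀ t : UForm R' S')) : Ginf P' Q' R' S')) = 1 := by
  have h := map_slDiag_exp_eq_one
    ((c.comp (cmBlockSectionAt L dV hdV hdV0 dW hdW hdW0 ι₁ v eP eQ eR eS)).comp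
      ((MonoidHom.inr (UForm P' Q') (UForm R' S')).comp (φV r₀ s₀))) t
  simpa only [MonoidHom.comp_apply, MonoidHom.inr_apply, hypV, slExp] using h

/-- **`hη` of `SmoothTheta` holds for every twist `η`.** [folklore] -/
theorem eta_archProdHom_cmBlockSectionAt_one_hypV (η : CMAdelic L dV × CMAdelic L dW →* ℂˣ) (r₀ : R') (s₀ : S') (t : ℝ) :
    η (archProdHom (↥(maximalRealSubfield L)) L (IsCMField.complexConj L) N M (Matrix.diagonal dV) (Matrix.diagonal dW)
      (cmBlockSectionAt L dV hdV hdV0 dW hdW hdW0 ι₁ v eP eQ eR eS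
        (((1 : UForm P' Q'), (hypV r₀ s₀ t : UForm R' S')) : Ginf P' Q' R' S'))) = 1 :=
  map_cmBlockSectionAt_one_hypV_eq_one L dV hdV hdV0 dW hdW hdW0 ι₁ v eP eQ eR eS
    (η.comp (archProdHom (↥(maximalRealSubfield L)) L (IsCMField.complexConj L) N M (Matrix.diagonal dV) (Matrix.diagonal dW)))
    r₀ s₀ t

/-! ## §2 The headline of `SmoothTheta`, `hη` discharged -/

variable
  (h₁V : ∃ i₀ : Fin N, (∀ i, i ≠ i₀ → 0 < (ι₁ (dV i)).re) ∨ ∀ i, i ≠ i₀ → (ι₁ (dV i)).re < 0)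
  (h₁W : (∀ j, 0 < (ι₁ (dW j)).re) ∨ ∀ j, (ι₁ (dW j)).re < 0)
  (hV : ∀ τ : L →+* ℂ, InfinitePlace.mk τ ≠ InfinitePlace.mk ι₁ →
    (∀ i, 0 < (τ (dV i)).re) ∨ ∀ i, (τ (dV i)).re < 0)
  (hW : ∀ τ : L →+* ℂ, InfinitePlace.mk τ ≠ InfinitePlace.mk ι₁ →
    (∃ j₀ : Fin M, ∀ j, j ≠ j₀ → 0 < (τ (dW j)).re) ∨ ∀ j, (τ (dW j)).re < 0)
variable (η : CMAdelic L dV × CMAdelic L dW →* ℂˣ) (Γ : Set (CMAdelic L dV × CMAdelic L dW))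

include h₁V h₁W hV hW in
/-- **(J-smooth) + (J-top) for the Weil theta model of the CM pin, no twist hypothesis**: for the normalised representation
`ρ = ω_ψ ∘ (s_pair ⊗ η)` (ANY `η`) with theta majorants, the small datum of the slot and `Ψ = F⁻¹(Φ₁ ⊠ Φ₂)`:
`t⁻¹ • (ρ(s(1,a_t)_𝔸) E(Ψ ⊗ f) − E(Ψ ⊗ f)) ⟶ E(F⁻¹((hypOpWGen Φ₁) ⊠ Φ₂) ⊗ f)` in the `Θ`-initial topology.
[Weil1964, Chap. III n° 39, n° 41 Thm 6; Folland1989, (4.24), Prop. (4.39)] -/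
theorem tendsto_toThetaTop_cmPairRepTwist_one_hypV_sub_div'
    (hρ : HasThetaMajorants fun (p : CMAdelic L dV × CMAdelic L dW) (Φ : CMSchwartz L n) =>
      cmPairRepTwist L e dV hdV hdV0 dW hdW hdW0 hGR η p Φ)
    {ω₁ : Representation ℂ (Ginf P' Q' R' S') (SchwartzMap (DPIdx P' Q' R' S' → ℝ) ℂ)}
    (hW₁ : IsArchWeilDatum (ι𝕎 P' Q' R' S') ω₁) (hc₁ : ∀ u, Continuous (ω₁ u)) (r₀ : R') (s₀ : S')
    (Φ₁ : SchwartzMap (DPIdx P' Q' R' S' → ℝ) ℂ)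
    (Φ₂ : SchwartzMap (Fin n × {w : {w : InfinitePlace ↥(maximalRealSubfield L) // w.IsReal} // w ≠ v} → ℝ) ℂ)
    (f : FinSB (↥(maximalRealSubfield L)) (Fin n)) :
    Tendsto (fun t : ℝ => ((t : ℝ) : ℂ)⁻¹ •
        ((repWeilThetaDatum (↥(maximalRealSubfield L)) (Fin n)
              (cmPairRepTwist L e dV hdV hdV0 dW hdW hdW0 hGR η).toHomUnits Γ).toThetaTop
            (cmPairRepTwist L e dV hdV hdV0 dW hdW hdW0 hGR η
              (archProdHom (↥(maximalRealSubfield L)) L (IsCMField.complexConj L) N M (Matrix.diagonal dV)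
                (Matrix.diagonal dW) (cmBlockSectionAt L dV hdV hdV0 dW hdW hdW0 ι₁ v eP eQ eR eS
                  (((1 : UForm P' Q'), (hypV r₀ s₀ t : UForm R' S')) : Ginf P' Q' R' S')))
              (piSchwartzBruhatEquiv (↥(maximalRealSubfield L)) (Fin n)
                ((cmBlockFrameAt L e dV hdV hdV0 dW hdW hdW0 ι₁ v eP eQ eR eS).symm (tensorPi Φ₁ Φ₂) ⊗ₜ f))) -
          (repWeilThetaDatum (↥(maximalRealSubfield L)) (Fin n)
              (cmPairRepTwist L e dV hdV hdV0 dW hdW hdW0 hGR η).toHomUnits Γ).toThetaTop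
            (piSchwartzBruhatEquiv (↥(maximalRealSubfield L)) (Fin n)
              ((cmBlockFrameAt L e dV hdV hdV0 dW hdW hdW0 ι₁ v eP eQ eR eS).symm (tensorPi Φ₁ Φ₂) ⊗ₜ f))))
      (𝓝[≠] 0)
      (𝓝 ((repWeilThetaDatum (↥(maximalRealSubfield L)) (Fin n)
              (cmPairRepTwist L e dV hdV hdV0 dW hdW hdW0 hGR η).toHomUnits Γ).toThetaTop
        (piSchwartzBruhatEquiv (↥(maximalRealSubfield L)) (Fin n)
          ((cmBlockFrameAt L e dV hdV hdV0 dW hdW hdW0 ι₁ v eP eQ eR eS).symm (tensorPi (hypOpWGen P' Q' r₀ s₀ Φ₁) Φ₂) ⊗ₜ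
            f)))) :=
  tendsto_toThetaTop_cmPairRepTwist_one_hypV_sub_div L e dV hdV hdV0 dW hdW hdW0 hGR η Γ ι₁ v eP eQ eR eS h₁V h₁W hV hW hρ
    hW₁ hc₁ r₀ s₀ (eta_archProdHom_cmBlockSectionAt_one_hypV L dV hdV hdV0 dW hdW hdW0 ι₁ v eP eQ eR eS η r₀ s₀) Φ₁ Φ₂ f

end BoostCharacter

end HodgeCM.Model.HypCensus

end
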